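import Summits.MatrixMultiplication.OmegaCensus.STPP211Z2pow6NFMapsC

/-!
# (2,1,1)¹⁰ ⊄ (ℤ/2)⁶ — part H1d: the GL normal-form maps of `𝔽₂⁶` (kernel-checked), for the normal-form layer (S3)

Cell `pub-omega` (unit `pub-omega-stpp-1-g36`), topic `Summits/MatrixMultiplication/OmegaCensus`.
HONEST FRAMING (verbatim): lottery ticket; floor = certified bounds/negative ranges. Census STRUCTURE bookkeeping (B5, `T1((ℤ/2)⁶)`, Pb237);
nothing here is a bound on `ω`.

Twin of the `𝔽₂⁵` maps of `STPP211Z2pow5Codes` (seat g35) one dimension up. `u j = dec 2ʲ` (`j < 6`) is the standard basis;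
`phi j v : G6 →+ G6` (any `v`) is additive and injective, and when `2ʲ ≤ enc v` it sends `v ↦ u j` and FIXES every `x` with `enc x < 2ʲ`
(the span of `u 0 … u (j−1)`). On codes (`phiC`): with `i` the top bit of `w = enc v`, `x ↦ swapᵢⱼ(x + xᵢ w) + xᵢ 2ʲ`. The four properties
are `decide`d by the kernel over the `64³` code triples, one theorem per `j` (`phiC_check0 … phiC_check5`). These maps drive the GL descent
of an arbitrary `c`-set `C ∋ 0` to a FRAME NORMAL FORM `{0, u 0, …, u (d−1)} ⊆ C ⊆ span` (`d = dim span C`), the first stage of the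
reduction «any `(2,1,1)¹⁰` family of `(ℤ/2)⁶` ↦ one of the 29 representative `c`-lists» (successor files).

References: H. Cohn, R. Kleinberg, B. Szegedy, C. Umans, FOCS 2005 (arXiv:math/0511460), Def. 5.1.
-/

namespace Summit.MatrixMultiplication.OmegaCensus

namespace T1Z2p6

open Finset

/-- All six checks. -/
theorem phiC_check {j : ℕ} (hj : j < 6) : phiCheck j = true := by
  rcases j with _ | _ | _ | _ | _ | _ | j
  · exact phiC_check0
  · exact phiC_check1
  · exact phiC_check2
  · exact phiC_check3
  · exact phiC_check4
  · exact phiC_check5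
  · omega

/-- Reading the check. -/
theorem phiC_spec {j w x y : ℕ} (hj : j < 6) (hw : w < 64) (hx : x < 64) (hy : y < 64) :
    phiC j w (Nat.xor x y) = Nat.xor (phiC j w x) (phiC j w y) ∧ phiC j w x < 64 ∧ (phiC j w x = phiC j w y → x = y) ∧
    (2 ^ j ≤ w → phiC j w w = 2 ^ j ∧ (x < 2 ^ j → phiC j w x = x)) := by
  have h := allC_spec (allC_spec (allC_spec (phiC_check hj) hw) hx) hy
  simp only [Bool.and_eq_true, beq_iff_eq, Nat.blt_eq, Bool.or_eq_true, Bool.not_eq_true', beq_eq_false_iff_ne,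
    ne_eq] at h
  obtain ⟨⟨⟨h1, h2⟩, h3⟩, h4⟩ := h
  refine ⟨h1, h2, fun e => ?_, fun hle => ?_⟩
  · rcases h3 with h3 | h3
    · exact absurd e h3
    · exact h3
  · rcases h4 with h4 | ⟨h5, h6⟩
    · exact absurd hle (not_le.2 h4)
    · refine ⟨h5, fun hxl => ?_⟩
      rcases h6 with h6 | h6
      · have : ¬ x < 2 ^ j := fun hh => by rw [← Nat.blt_eq] at hh; rw [hh] at h6; exact Bool.noConfusion h6
        exact absurd hxl this
      · exact h6

/-! ## The normal-form maps as homomorphisms -/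

/-- The normal-form maps are additive. -/
theorem phiFun_add (j : Fin 6) (v x y : G6) : phiFun j v (x + y) = phiFun j v x + phiFun j v y := by
  unfold phiFun
  rw [enc_add, (phiC_spec j.isLt (enc_lt v) (enc_lt x) (enc_lt y)).1,
    dec_xor _ (phiC_spec j.isLt (enc_lt v) (enc_lt x) (enc_lt x)).2.1 _ (phiC_spec j.isLt (enc_lt v) (enc_lt y) (enc_lt y)).2.1]

/-- The normal-form maps are injective. -/
theorem phiFun_inj (j : Fin 6) (v x y : G6) (h : phiFun j v x = phiFun j v y) : x = y := by
  unfold phiFun at h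
  have h' : phiC j (enc v) (enc x) = phiC j (enc v) (enc y) := by
    have := congrArg enc h
    rwa [enc_dec _ (phiC_spec j.isLt (enc_lt v) (enc_lt x) (enc_lt x)).2.1,
      enc_dec _ (phiC_spec j.isLt (enc_lt v) (enc_lt y) (enc_lt y)).2.1] at this
  exact enc_injective ((phiC_spec j.isLt (enc_lt v) (enc_lt x) (enc_lt y)).2.2.1 h')

/-- The normal-form map sends `v ↦ u j` when `2ʲ ≤ enc v`. -/
theorem phiFun_self (j : Fin 6) (v : G6) (h : 2 ^ j.val ≤ enc v) : phiFun j v v = u j := by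
  unfold phiFun u
  rw [((phiC_spec j.isLt (enc_lt v) (enc_lt v) (enc_lt v)).2.2.2 h).1]

/-- The normal-form map fixes the span of `u 0 … u (j−1)` pointwise when `2ʲ ≤ enc v`. -/
theorem phiFun_fix (j : Fin 6) (v x : G6) (h : 2 ^ j.val ≤ enc v) (hx : enc x < 2 ^ j.val) : phiFun j v x = x := by
  unfold phiFun
  rw [((phiC_spec j.isLt (enc_lt v) (enc_lt x) (enc_lt x)).2.2.2 h).2 hx, dec_enc]

/-- **The normal-form map as a homomorphism.** -/
def phi (j : Fin 6) (v : G6) : G6 →+ G6 := AddMonoidHom.mk' (phiFun j v) (phiFun_add j v)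

/-- `phi` is injective. -/
theorem phi_injective (j : Fin 6) (v : G6) : Function.Injective (phi j v) := fun x y h => phiFun_inj j v x y h

/-- `phi j v v = u j`. -/
theorem phi_self (j : Fin 6) {v : G6} (h : 2 ^ j.val ≤ enc v) : phi j v v = u j := phiFun_self j v h

/-- `phi j v` fixes the span of `u 0 … u (j−1)`. -/
theorem phi_fix (j : Fin 6) {v x : G6} (h : 2 ^ j.val ≤ enc v) (hx : enc x < 2 ^ j.val) : phi j v x = x := phiFun_fix j v x h hx

/-! ## Linear maps from column codes (for coordinate permutations and orbit certificates) -/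

/-- The linear map on codes with `u b ↦ h[b]`: XOR of the `h[b]` over the set bits `b < 6` of `x`. -/
def linC (h : List ℕ) (x : ℕ) : ℕ :=
  Nat.xor (Nat.xor (Nat.xor (Nat.xor (Nat.xor (if x.testBit 0 then h.getD 0 0 else 0) (if x.testBit 1 then h.getD 1 0 else 0))
    (if x.testBit 2 then h.getD 2 0 else 0)) (if x.testBit 3 then h.getD 3 0 else 0)) (if x.testBit 4 then h.getD 4 0 else 0))
    (if x.testBit 5 then h.getD 5 0 else 0)

/-- The linear map with column codes `h`, as a function on `G6`. -/
def linFun (h : List ℕ) (x : G6) : G6 := dec (linC h (enc x))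

/-- One column's contribution is additive for XOR. -/
theorem col_xor (a x y b : ℕ) :
    (if (Nat.xor x y).testBit b then a else 0) = Nat.xor (if x.testBit b then a else 0) (if y.testBit b then a else 0) := by
  rw [show Nat.xor x y = x ^^^ y from rfl, Nat.testBit_xor]
  cases x.testBit b <;> cases y.testBit b <;> simp

/-- **`linC` is additive for XOR** (by construction, any columns). -/
theorem linC_xor (h : List ℕ) (x y : ℕ) : linC h (Nat.xor x y) = Nat.xor (linC h x) (linC h y) := by
  unfold linC
  simp only [col_xor]
  simp only [show ∀ p q : ℕ, Nat.xor p q = p ^^^ q from fun _ _ => rfl]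
  ac_rfl

/-- `linC` stays below `64` when the six columns do. -/
theorem linC_lt {h : List ℕ} (hh : ∀ b < 6, h.getD b 0 < 64) (x : ℕ) : linC h x < 64 := by
  have c : ∀ b < 6, (if x.testBit b then h.getD b 0 else 0) < 2 ^ 6 := fun b hb => by
    by_cases hx : x.testBit b = true
    · rw [if_pos hx]; exact hh b hb
    · rw [if_neg hx]; decide
  unfold linC
  simp only [show ∀ p q : ℕ, Nat.xor p q = p ^^^ q from fun _ _ => rfl]
  exact Nat.xor_lt_two_pow (Nat.xor_lt_two_pow (Nat.xor_lt_two_pow (Nat.xor_lt_two_pow (Nat.xor_lt_two_pow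
    (c 0 (by decide)) (c 1 (by decide))) (c 2 (by decide))) (c 3 (by decide))) (c 4 (by decide))) (c 5 (by decide))

/-- The CHEAP kernel check of a column list: six columns `< 64` and trivial kernel (`linC h x ≠ 0` for `0 < x < 64`). -/
def linOK (h : List ℕ) : Bool :=
  (List.range 6).all (fun b => Nat.blt (h.getD b 0) 64) && allC fun x => Nat.beq x 0 || !(Nat.beq (linC h x) 0)

/-- Reading `linOK`. -/
theorem linOK_spec {h : List ℕ} (hc : linOK h = true) : (∀ b < 6, h.getD b 0 < 64) ∧ ∀ x < 64, linC h x = 0 → x = 0 := by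
  unfold linOK at hc
  rw [Bool.and_eq_true, List.all_eq_true] at hc
  refine ⟨fun b hb => ?_, fun x hx h0 => ?_⟩
  · have := hc.1 b (List.mem_range.2 hb); rwa [Nat.blt_eq] at this
  · have h1 := allC_spec hc.2 hx
    rw [Bool.or_eq_true] at h1
    rcases h1 with h1 | h1
    · exact Nat.eq_of_beq_eq_true h1
    · rw [h0] at h1; exact absurd h1 (by decide)

/-- A checked column list gives an additive and injective map. -/
theorem lin_hom {h : List ℕ} (hc : linOK h = true) :
    (∀ x y : G6, linFun h (x + y) = linFun h x + linFun h y) ∧ Function.Injective (linFun h) := by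
  obtain ⟨hcol, hker⟩ := linOK_spec hc
  refine ⟨fun x y => ?_, fun x y e => ?_⟩
  · unfold linFun
    rw [enc_add, linC_xor, dec_xor _ (linC_lt hcol _) _ (linC_lt hcol _)]
  · unfold linFun at e
    have e' : linC h (enc x) = linC h (enc y) := by
      have := congrArg enc e
      rwa [enc_dec _ (linC_lt hcol _), enc_dec _ (linC_lt hcol _)] at this
    have h0 : linC h (Nat.xor (enc x) (enc y)) = 0 := by
      rw [linC_xor, e', show ∀ p q : ℕ, Nat.xor p q = p ^^^ q from fun _ _ => rfl, Nat.xor_self]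
    have hxy : Nat.xor (enc x) (enc y) = 0 :=
      hker _ (by rw [show Nat.xor (enc x) (enc y) = enc x ^^^ enc y from rfl]
                 exact Nat.xor_lt_two_pow (n := 6) (enc_lt x) (enc_lt y)) h0
    have hxy' : enc x ^^^ enc y = 0 := hxy
    have h1 : enc x ^^^ (enc x ^^^ enc y) = enc x := by rw [hxy', Nat.xor_zero]
    rw [← Nat.xor_assoc, Nat.xor_self, Nat.zero_xor] at h1
    exact enc_injective h1.symm

/-- **The checked linear map as a homomorphism.** -/
def lin (h : List ℕ) (hc : linOK h = true) : G6 →+ G6 := AddMonoidHom.mk' (linFun h) (lin_hom hc).1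

/-- `lin` is injective. -/
theorem lin_injective (h : List ℕ) (hc : linOK h = true) : Function.Injective (lin h hc) := (lin_hom hc).2

end T1Z2p6

end Summit.MatrixMultiplication.OmegaCensus
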